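import Summits.HodgeConjecture.HodgeConjecture.Theorems.K2E3HyperbolicPairTransport        -- W3 (this seat): `lineRootGL_partner_mem`, `lineRoot_partner_mulVec`, `lineRoot_partner_mulVec_left`
import Summits.HodgeConjecture.HodgeConjecture.Theorems.K2E3WittLeviCartanRecursionTame     -- ★ p856461 (this seat) §1 diagonal block lemmas; brings ★ `HyperspecialUnitaryParabolicBlocks`, ★ `UnitaryRankOneBorelModulusIndex` (`coe_inv_apply_unitary`, `sum_map_mul_rev_apply_eq`)
import Literature.NumberTheory.Automorphic.HyperspecialUnitaryCartanFrames                 -- ★ `Fin.eq_of_rev_eq_self` (the `rev`-fixed index is unique)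
import HarnessLib

/-!
# Cartan decomposition of the quasi-split unitary group `U(σ, J₀)(K)` for ANY isometric involution `σ` — I: the pivot and the elimination step
# (crux H413, U12-g ∕ 13a road A; `K₀ = U ∩ GL_N(𝒪)` is special at every place: Tits 1979 §3.3.3, Bruhat–Tits 1972 (4.4.3))

Cell `hodgecm-mathlib`, Track B «K2-LIT», crux item `stmt-HodgeConjecture-24833` (h413), line `K2_E3_EllipticInputs`, row 13a `sig_K2E3LocalIrrepAdmissible`; seat K2E3-p09
(g3), item (W) of the line lead's RULINGS #9 (wild ramified places).  THEOREMS ONLY — no `def`, no named fact, no instance, no notation, no `sorry`; count-neutral helper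
(`--supports stmt-HodgeConjecture-24833 --as helper`).

THE POINT.  ★ `HermitianLattice.exists_cartan_antidiagonal_of_trace_norm` (K2E3-p23) proves `U(σ, J₀)(K) = K₀ · T · K₀` under (trace) + (norm), which FAIL at the wildly
ramified quadratic extensions.  The decomposition itself holds for EVERY isometric involution (`𝒪^N` is a self-dual lattice for `J₀`, so its stabiliser `K₀` is a special
maximal compact subgroup), and here is an ELEMENTARY proof by HERMITIAN ELIMINATION WITH A MAXIMAL PIVOT, using nothing but the ultrametric inequality, `v ∘ σ = v`
and the `J₀`-unitarity identities `∑_i σ(g_{ia}) g_{rev i, b} = δ_{b, rev a}` (★ `sum_map_mul_rev_apply_eq`) and `(g⁻¹)_{ab} = σ(g_{rev b, rev a})` (★ `coe_inv_apply_unitary`).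
Let `M = max_{ij} |g_{ij}| > 1`.

* §1 VALUATION TOOLS for `h = hermForm σ J₀` (`h(x,y) = ∑ σ(x_i) y_{rev i}`, `hermRow x = (σ x_{rev j})_j`) and the ROOT ELEMENTS ★ `lineRoot σ J₀ x w z` (integral for
  integral data: `v_lineRoot_apply_le_one`).
* §2 THE PIVOT (`exists_pivot_row`): in a column `t` of `g ∈ U` whose entries are bounded by `M` and attain `M`, SOME ROW `s` WITH `s ≠ rev s` attains `M`, provided
  `t ≠ rev t` or `1 < M` — otherwise the middle term `σ(g_{mt}) g_{mt}` of `∑_i σ(g_{it}) g_{rev i,t} = [t = rev t]` would dominate: `M² = |0|` or `M² = |1|`.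
* §3 THE STEP (`exists_conj_eigen_of_pivot`): if the maximal entry of `g ∈ U` (bound `M`) sits at `(s, t)` with `s ≠ rev s`, `t ≠ rev t`, then with `λ = g_{st}`,
  `ẽ = λ⁻¹ g e_t` (integral, isotropic, `ẽ_s = 1`) and `x₂′ = (σλ)⁻¹ g⁻¹ e_{rev s}` (integral — column `rev s` of `g⁻¹` is `σ` of row `s` of `g`; isotropic; `h(e_t, x₂′) = 1`) the
  two root elements `ω₁ = T_{e_{rev s}}(lineProj ẽ, h(e_s, ẽ))` (`e_s ↦ ẽ`, fixes `e_{rev s}`) and `ω₂ = T_{e_t}(lineProj x₂′, h(e_{rev t}, x₂′))` (`e_{rev t} ↦ x₂′`, fixes `e_t`) — both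
  ★ W3 §2 — lie in `K₀`, and `q = ω₁⁻¹ g ω₂` satisfies `q e_t = λ e_s`, `q e_{rev t} = (σλ)⁻¹ e_{rev s}`.
The sequel `K2E3QuasiSplitUnitaryCartanAnyInvolution` moves `(s, t)` to `(0, 0)` by `rev`-commuting permutation matrices (∈ `K₀`), reads off that `q` is block diagonal
`(λ ∣ q″ ∣ (σλ)⁻¹)`, and inducts on `N` through ★ `midBlockU` ∕ ★ `blockDiagLift` ∕ ★ rigidity.

HONEST LABEL: structure lemma; HC_CM is proved only modulo the 7 printed citations (2 remaining named inputs: hLiu418 = stmt-HodgeConjecture-24832, h413 =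
stmt-HodgeConjecture-24833) until rung 0 closes.

## References
* [BruhatTits1972] F. Bruhat, J. Tits, *Groupes réductifs sur un corps local I*, Publ. Math. IHÉS 41 (1972), (4.4.3) (`G = K Λ⁺ K` for a good maximal compact `K`).
* [Tits1979] J. Tits, *Reductive groups over local fields*, PSPM 33.1 (1979), §3.3.3 (the stabiliser of a self-dual lattice is special).
* [Dieudonne1971GroupesClassiques] J. Dieudonné, *La géométrie des groupes classiques*, 3e éd. (1971), Chap. II §5 (transvections of an isotropic line).
* [Macdonald1995] I. G. Macdonald, *Symmetric Functions and Hall Polynomials*, 2nd ed. (1995), Ch. V §2 (elimination with a maximal pivot for `GL_n`).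
-/

set_option autoImplicit false
-- the mandated namespace repeats `HodgeConjecture.HodgeConjecture`, as in every `Theorems/*.lean` of this sub-problem
set_option linter.dupNamespace false

noncomputable section

open scoped Valued WithZero Matrix MatrixGroups
open Matrix

namespace Summit.HodgeConjecture.HodgeConjecture.Cruxes.H413.K2E3QuasiSplitUnitaryCartanAnyInvolutionStep

open Literature.NumberTheory.Automorphic Literature.NumberTheory.Automorphic.UnitaryGroup Literature.NumberTheory.Automorphic.HermitianLattice
open K2E3HyperbolicPairTransport

/-! ## §1 Valuation tools for `h = hermForm σ J₀` and the root elements -/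

section Form

variable {K : Type*} [Field K] (σ : K →+* K) {N : ℕ}

/-- `J₀` is `σ`-hermitian: `(σ J₀)ᵀ = J₀` (entries `0`, `1`; symmetric). [cite: Dieudonne1971GroupesClassiques, Chap. II §5] -/
theorem antidiagonal_map_transpose : (((StdForm.antidiagonal N).over K).map σ)ᵀ = (StdForm.antidiagonal N).over K := by
  ext i j
  rw [Matrix.transpose_apply, Matrix.map_apply, antidiagonal_over_apply, antidiagonal_over_apply]
  by_cases h : i = Fin.rev j
  · rw [if_pos h, if_pos (by rw [h, Fin.rev_rev]), map_one]
  · rw [if_neg h, if_neg (fun h' => h (by rw [h', Fin.rev_rev])), map_zero]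

/-- `(J₀ v)_i = v_{rev i}`. [cite: Dieudonne1971GroupesClassiques, Chap. II §5] -/
theorem antidiagonal_mulVec_apply (v : Fin N → K) (i : Fin N) : ((StdForm.antidiagonal N).over K *ᵥ v) i = v (Fin.rev i) := by
  rw [Matrix.mulVec, dotProduct, Finset.sum_eq_single (Fin.rev i)]
  · rw [antidiagonal_over_apply, if_pos rfl, one_mul]
  · intro j _ hj; rw [antidiagonal_over_apply, if_neg hj, zero_mul]
  · intro h; exact absurd (Finset.mem_univ _) h

/-- **`h(x, y) = ∑_i σ(x_i) y_{rev i}`** for `h = hermForm σ J₀`. [cite: Dieudonne1971GroupesClassiques, Chap. II §5] -/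
theorem hermForm_antidiagonal_apply (x y : Fin N → K) :
    hermForm σ ((StdForm.antidiagonal N).over K) x y = ∑ i, σ (x i) * y (Fin.rev i) := by
  rw [hermForm_apply, dotProduct]
  exact Finset.sum_congr rfl fun i _ => by rw [Function.comp_apply, antidiagonal_mulVec_apply]

/-- `h(e_a, v) = v_{rev a}`. [cite: Dieudonne1971GroupesClassiques, Chap. II §5] -/
theorem hermForm_single_left (a : Fin N) (v : Fin N → K) : hermForm σ ((StdForm.antidiagonal N).over K) (Pi.single a 1) v = v (Fin.rev a) := by
  rw [hermForm_antidiagonal_apply, Finset.sum_eq_single a]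
  · rw [Pi.single_eq_same, map_one, one_mul]
  · intro i _ hi; rw [Pi.single_eq_of_ne hi, map_zero, zero_mul]
  · intro h; exact absurd (Finset.mem_univ _) h

/-- `h(v, e_b) = σ(v_{rev b})`. [cite: Dieudonne1971GroupesClassiques, Chap. II §5] -/
theorem hermForm_single_right (v : Fin N → K) (b : Fin N) :
    hermForm σ ((StdForm.antidiagonal N).over K) v (Pi.single b 1) = σ (v (Fin.rev b)) := by
  rw [hermForm_antidiagonal_apply, Finset.sum_eq_single (Fin.rev b)]
  · rw [Fin.rev_rev, Pi.single_eq_same, mul_one]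
  · intro i _ hi; rw [Pi.single_eq_of_ne (fun h => hi (by rw [← h, Fin.rev_rev])), mul_zero]
  · intro h; exact absurd (Finset.mem_univ _) h

/-- `h(e_a, e_b) = [b = rev a]`. [cite: Dieudonne1971GroupesClassiques, Chap. II §5] -/
theorem hermForm_single_single_antidiagonal (a b : Fin N) :
    hermForm σ ((StdForm.antidiagonal N).over K) (Pi.single a 1) (Pi.single b 1) = if b = Fin.rev a then 1 else 0 := by
  rw [hermForm_single_single, antidiagonal_over_apply]

/-- `(hermRow x)_j = σ(x_{rev j})` for `J₀`. [cite: Dieudonne1971GroupesClassiques, Chap. II §5] -/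
theorem hermRow_antidiagonal_apply (x : Fin N → K) (j : Fin N) : hermRow σ ((StdForm.antidiagonal N).over K) x j = σ (x (Fin.rev j)) := by
  rw [hermRow, Matrix.vecMul, dotProduct, Finset.sum_eq_single (Fin.rev j)]
  · rw [Function.comp_apply, antidiagonal_over_apply, if_pos (Fin.rev_rev j).symm, mul_one]
  · intro i _ hi; rw [antidiagonal_over_apply, if_neg (fun h => hi (by rw [h, Fin.rev_rev])), mul_zero]
  · intro h; exact absurd (Finset.mem_univ _) h

/-- A column of `g` as `g e_t`. [folklore] -/
theorem mulVec_single_one_eq (g : Matrix (Fin N) (Fin N) K) (t : Fin N) : g *ᵥ Pi.single t 1 = fun i => g i t := by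
  ext i
  rw [Matrix.mulVec, dotProduct, Finset.sum_eq_single t]
  · rw [Pi.single_eq_same, mul_one]
  · intro j _ hj; rw [Pi.single_eq_of_ne hj, mul_zero]
  · intro h; exact absurd (Finset.mem_univ _) h

variable [Valued K ℤᵐ⁰]

/-- **Ultrametric bound for `h`**: `|h(x,y)| ≤ a·b` when `|x_i| ≤ a`, `|y_i| ≤ b` (`v ∘ σ = v`). [cite: Dieudonne1971GroupesClassiques, Chap. II §5] -/
theorem v_hermForm_le (hvσ : ∀ x, Valued.v (σ x) = Valued.v x) {x y : Fin N → K} {a b : ℤᵐ⁰} (hx : ∀ i, Valued.v (x i) ≤ a)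
    (hy : ∀ i, Valued.v (y i) ≤ b) : Valued.v (hermForm σ ((StdForm.antidiagonal N).over K) x y) ≤ a * b := by
  rw [hermForm_antidiagonal_apply]
  refine Valuation.map_sum_le _ fun i _ => ?_
  rw [map_mul, hvσ]
  exact mul_le_mul' (hx i) (hy _)

/-- **Root elements with integral data are integral**: `|x_i|, |w_i|, |z| ≤ 1 ⇒ |T_x(w, z)_{ij}| ≤ 1` (entry `δ_{ij} + w_i σ(x_{rev j}) + x_i (z σ(x_{rev j}) − σ(w_{rev j}))`).
[cite: Dieudonne1971GroupesClassiques, Chap. II §5] [cite: Tits1979, §3.3.3] -/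
theorem v_lineRoot_apply_le_one (hvσ : ∀ x, Valued.v (σ x) = Valued.v x) {x w : Fin N → K} {z : K} (hx : ∀ i, Valued.v (x i) ≤ 1)
    (hw : ∀ i, Valued.v (w i) ≤ 1) (hz : Valued.v z ≤ 1) (i j : Fin N) :
    Valued.v (lineRoot σ ((StdForm.antidiagonal N).over K) x w z i j) ≤ 1 := by
  rw [lineRoot, Matrix.add_apply, Matrix.add_apply, Matrix.vecMulVec_apply, Matrix.vecMulVec_apply, Pi.sub_apply, Pi.smul_apply, smul_eq_mul,
    hermRow_antidiagonal_apply, hermRow_antidiagonal_apply]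
  have h1 : Valued.v ((1 : Matrix (Fin N) (Fin N) K) i j) ≤ 1 := by
    rw [Matrix.one_apply]; split_ifs
    · rw [map_one]
    · rw [map_zero]; exact zero_le_one
  refine (Valued.v.map_add _ _).trans (max_le ((Valued.v.map_add _ _).trans (max_le h1 ?_)) ?_)
  · rw [map_mul, hvσ]; exact mul_le_one' (hw i) (hx _)
  · rw [map_mul]
    refine mul_le_one' (hx i) ((Valued.v.map_sub _ _).trans (max_le ?_ ?_))
    · rw [map_mul, hvσ]; exact mul_le_one' hz (hx _)
    · rw [hvσ]; exact hw _

/-- `|lineProj_{e_a, e_b} v| ≤ 1` for integral `v` (its coefficients are `h(e_b, v) = v_{rev b}`, `h(e_a, v) = v_{rev a}`). [cite: Dieudonne1971GroupesClassiques, Chap. II §5] -/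
theorem v_lineProj_single_apply_le_one {v : Fin N → K} (hv : ∀ i, Valued.v (v i) ≤ 1) (a b i : Fin N) :
    Valued.v (lineProj σ ((StdForm.antidiagonal N).over K) (Pi.single a 1) (Pi.single b 1) v i) ≤ 1 := by
  rw [lineProj, hermForm_single_left, hermForm_single_left, Pi.sub_apply, Pi.sub_apply, Pi.smul_apply, Pi.smul_apply, smul_eq_mul, smul_eq_mul]
  have hs : ∀ c : Fin N, Valued.v (Pi.single (M := fun _ : Fin N => K) c (1 : K) i) ≤ 1 := fun c => by
    by_cases h : i = c
    · subst h; rw [Pi.single_eq_same, map_one]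
    · rw [Pi.single_eq_of_ne h, map_zero]; exact zero_le_one
  refine (Valued.v.map_sub _ _).trans (max_le ((Valued.v.map_sub _ _).trans (max_le (hv i) ?_)) ?_)
  · rw [map_mul]; exact mul_le_one' (hv _) (hs a)
  · rw [map_mul]; exact mul_le_one' (hv _) (hs b)

end Form

/-! ## §2 The pivot -/

section Pivot

variable {K : Type*} [Field K] [Valued K ℤᵐ⁰] {σ : K →+* K} {N : ℕ}

/-- **THE PIVOT ROW.**  Let `g ∈ U(σ, J₀)`, `t` a column whose entries are bounded by `M ≠ 0` and attain `M`, and assume `t ≠ rev t` OR `1 < M`.  Then some row `s` with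
`s ≠ rev s` attains `M` in column `t`: otherwise only the `rev`-fixed row `m` does, and in `∑_i σ(g_{it}) g_{rev i, t} = [t = rev t]` (★ `sum_map_mul_rev_apply_eq`) the
term `σ(g_{mt}) g_{mt}` of valuation `M²` strictly dominates — giving `M² = |0|` if `t ≠ rev t`, `M² = |1|` if `t = rev t`.
[cite: Macdonald1995, Ch. V §2] [cite: BruhatTits1972, (4.4.3)] -/
theorem exists_pivot_row (hvσ : ∀ x, Valued.v (σ x) = Valued.v x) (g : unitaryGroupOfForm σ ((StdForm.antidiagonal N).over K))
    (t : Fin N) {M : ℤᵐ⁰} (hM0 : M ≠ 0) (hle : ∀ i, Valued.v (((g : GL (Fin N) K) : Matrix (Fin N) (Fin N) K) i t) ≤ M)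
    (hex : ∃ i, Valued.v (((g : GL (Fin N) K) : Matrix (Fin N) (Fin N) K) i t) = M) (ht : t ≠ Fin.rev t ∨ 1 < M) :
    ∃ s, s ≠ Fin.rev s ∧ Valued.v (((g : GL (Fin N) K) : Matrix (Fin N) (Fin N) K) s t) = M := by
  by_contra hcon
  push Not at hcon
  obtain ⟨m, hm⟩ := hex
  set A : Matrix (Fin N) (Fin N) K := ((g : GL (Fin N) K) : Matrix (Fin N) (Fin N) K) with hA
  -- the maximising row is `rev`-fixed, and unique
  have hmrev : Fin.rev m = m := by
    by_contra h; exact absurd hm (hcon m (Ne.symm h))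
  have hlt : ∀ i, i ≠ m → Valued.v (A i t) < M := fun i hi => by
    refine lt_of_le_of_ne (hle i) fun h => hi ?_
    have hirev : Fin.rev i = i := by by_contra h'; exact absurd h (hcon i (Ne.symm h'))
    exact Fin.eq_of_rev_eq_self hirev hmrev
  -- the unitarity sum, split at `m`
  have hsum := sum_map_mul_rev_apply_eq g t t
  rw [← Finset.add_sum_erase _ _ (Finset.mem_univ m)] at hsum
  have hrest : Valued.v (∑ i ∈ Finset.univ.erase m, σ (A i t) * A (Fin.rev i) t) < M * M := by
    refine Valuation.map_sum_lt _ (mul_ne_zero hM0 hM0) fun i hi => ?_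
    have him : i ≠ m := Finset.ne_of_mem_erase hi
    rw [map_mul, hvσ]
    rcases eq_or_ne (Valued.v (A (Fin.rev i) t)) 0 with h0 | h0
    · rw [h0, mul_zero]; exact zero_lt_iff.2 (mul_ne_zero hM0 hM0)
    · calc Valued.v (A i t) * Valued.v (A (Fin.rev i) t) < M * Valued.v (A (Fin.rev i) t) :=
            mul_lt_mul_of_pos_right (hlt i him) (zero_lt_iff.2 h0)
        _ ≤ M * M := mul_le_mul' le_rfl (hle _)
  have hmain : Valued.v (σ (A m t) * A (Fin.rev m) t) = M * M := by rw [map_mul, hvσ, hmrev, hm]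
  have hval : Valued.v (σ (A m t) * A (Fin.rev m) t + ∑ i ∈ Finset.univ.erase m, σ (A i t) * A (Fin.rev i) t) = M * M := by
    have h := Valued.v.map_add_eq_of_lt_left (x := σ (A m t) * A (Fin.rev m) t)
      (y := ∑ i ∈ Finset.univ.erase m, σ (A i t) * A (Fin.rev i) t) (by rw [hmain]; exact hrest)
    rw [h, hmain]
  rw [hsum] at hval
  by_cases htt : t = Fin.rev t
  · rw [if_pos htt, map_one] at hval
    rcases ht with ht | hM1
    · exact ht htt
    · have h0M : (0 : ℤᵐ⁰) < M := lt_trans zero_lt_one hM1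
      have h2 : (1 : ℤᵐ⁰) < M * M := by
        have h3 : M * 1 < M * M := mul_lt_mul_of_pos_left hM1 h0M
        rw [mul_one] at h3
        exact lt_trans hM1 h3
      exact ne_of_gt h2 hval.symm
  · rw [if_neg htt, map_zero] at hval
    exact hM0 (mul_self_eq_zero.1 hval.symm)

end Pivot

/-! ## §3 The elimination step -/

section Step

variable {K : Type*} [Field K] [Valued K ℤᵐ⁰] {σ : K →+* K} {N : ℕ}

/-- Standard basis vectors are integral. [folklore] -/
theorem v_single_apply_le_one (c i : Fin N) : Valued.v (Pi.single (M := fun _ : Fin N => K) c (1 : K) i) ≤ 1 := by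
  by_cases h : i = c
  · subst h; rw [Pi.single_eq_same, map_one]
  · rw [Pi.single_eq_of_ne h, map_zero]; exact zero_le_one

/-- **THE ELIMINATION STEP of the Cartan decomposition of `U(σ, J₀)` for any isometric involution `σ`.**  If the entries of `g ∈ U` are bounded by `M ≠ 0` and
`|g_{st}| = M` at a position with `s ≠ rev s`, `t ≠ rev t`, then there are `ω₁, ω₂ ∈ K₀ = U ∩ GL_N(𝒪)` (root elements of the lines `K e_{rev s}`, `K e_t`, ★ W3 §2) with
`q = ω₁⁻¹ g ω₂` satisfying `q e_t = g_{st} · e_s` and `q e_{rev t} = (σ g_{st})⁻¹ · e_{rev s}` — see the module docstring for the construction (`ẽ = g_{st}⁻¹ g e_t`,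
`x₂′ = (σ g_{st})⁻¹ g⁻¹ e_{rev s}`, both integral and isotropic). [cite: BruhatTits1972, (4.4.3)] [cite: Tits1979, §3.3.3] [cite: Macdonald1995, Ch. V §2] -/
theorem exists_conj_eigen_of_pivot (hσ : ∀ x, σ (σ x) = x) (hvσ : ∀ x, Valued.v (σ x) = Valued.v x)
    (g : unitaryGroupOfForm σ ((StdForm.antidiagonal N).over K)) {M : ℤᵐ⁰} (hM0 : M ≠ 0)
    (hle : ∀ i j, Valued.v (((g : GL (Fin N) K) : Matrix (Fin N) (Fin N) K) i j) ≤ M) {s t : Fin N} (hs : s ≠ Fin.rev s) (ht : t ≠ Fin.rev t)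
    (hst : Valued.v (((g : GL (Fin N) K) : Matrix (Fin N) (Fin N) K) s t) = M) :
    ∃ ω₁ ω₂ : unitaryGroupOfForm σ ((StdForm.antidiagonal N).over K),
      ω₁ ∈ unitaryInt σ ((StdForm.antidiagonal N).over K) ∧ ω₂ ∈ unitaryInt σ ((StdForm.antidiagonal N).over K) ∧
      (((ω₁⁻¹ * g * ω₂ : unitaryGroupOfForm σ ((StdForm.antidiagonal N).over K)) : GL (Fin N) K) : Matrix (Fin N) (Fin N) K) *ᵥ Pi.single t 1 =
        ((g : GL (Fin N) K) : Matrix (Fin N) (Fin N) K) s t • Pi.single s 1 ∧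
      (((ω₁⁻¹ * g * ω₂ : unitaryGroupOfForm σ ((StdForm.antidiagonal N).over K)) : GL (Fin N) K) : Matrix (Fin N) (Fin N) K) *ᵥ Pi.single (Fin.rev t) 1 =
        (σ (((g : GL (Fin N) K) : Matrix (Fin N) (Fin N) K) s t))⁻¹ • Pi.single (Fin.rev s) 1 := by
  set A : Matrix (Fin N) (Fin N) K := ((g : GL (Fin N) K) : Matrix (Fin N) (Fin N) K) with hA
  have hH : (((StdForm.antidiagonal N).over K).map σ)ᵀ = (StdForm.antidiagonal N).over K := antidiagonal_map_transpose σ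
  have hgU : (A.map σ)ᵀ * (StdForm.antidiagonal N).over K * A = (StdForm.antidiagonal N).over K := mem_unitaryGroupOfForm_iff.1 g.2
  have hgiU : ((((g⁻¹ : unitaryGroupOfForm σ ((StdForm.antidiagonal N).over K)) : GL (Fin N) K) : Matrix (Fin N) (Fin N) K).map σ)ᵀ * (StdForm.antidiagonal N).over K *
      (((g⁻¹ : unitaryGroupOfForm σ ((StdForm.antidiagonal N).over K)) : GL (Fin N) K) : Matrix (Fin N) (Fin N) K) = (StdForm.antidiagonal N).over K := mem_unitaryGroupOfForm_iff.1 (g⁻¹).2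
  set lam : K := A s t with hlam
  have hlam0 : lam ≠ 0 := fun h => hM0 (by rw [← hst, h, map_zero])
  have hσlam0 : σ lam ≠ 0 := (map_ne_zero σ).2 hlam0
  -- isotropy of the standard vectors involved
  have hxt : hermForm σ ((StdForm.antidiagonal N).over K) (Pi.single t 1) (Pi.single t 1) = 0 := by rw [hermForm_single_single_antidiagonal, if_neg ht]
  have hyt : hermForm σ ((StdForm.antidiagonal N).over K) (Pi.single (Fin.rev t) 1) (Pi.single (Fin.rev t) 1) = 0 := by
    rw [hermForm_single_single_antidiagonal, if_neg (by rw [Fin.rev_rev]; exact Ne.symm ht)]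
  have hxtyt : hermForm σ ((StdForm.antidiagonal N).over K) (Pi.single t 1) (Pi.single (Fin.rev t) 1) = 1 := by rw [hermForm_single_single_antidiagonal, if_pos rfl]
  have hx1 : hermForm σ ((StdForm.antidiagonal N).over K) (Pi.single (Fin.rev s) 1) (Pi.single (Fin.rev s) 1) = 0 := by
    rw [hermForm_single_single_antidiagonal, if_neg (by rw [Fin.rev_rev]; exact Ne.symm hs)]
  have hy1 : hermForm σ ((StdForm.antidiagonal N).over K) (Pi.single s 1) (Pi.single s 1) = 0 := by rw [hermForm_single_single_antidiagonal, if_neg hs]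
  have hx1y1 : hermForm σ ((StdForm.antidiagonal N).over K) (Pi.single (Fin.rev s) 1) (Pi.single s 1) = 1 := by
    rw [hermForm_single_single_antidiagonal, if_pos (Fin.rev_rev s).symm]
  -- the column `u = g e_t` and `ẽ = λ⁻¹ u`
  set u : Fin N → K := fun i => A i t with hu
  have hgu : A *ᵥ Pi.single t 1 = u := mulVec_single_one_eq A t
  set et : Fin N → K := lam⁻¹ • u with het
  have het_s : et s = 1 := by rw [het, Pi.smul_apply, smul_eq_mul]; exact inv_mul_cancel₀ hlam0
  have het_int : ∀ i, Valued.v (et i) ≤ 1 := fun i => by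
    rw [het, Pi.smul_apply, smul_eq_mul, map_mul, map_inv₀, hst]
    calc M⁻¹ * Valued.v (A i t) ≤ M⁻¹ * M := mul_le_mul' le_rfl (hle i t)
      _ = 1 := inv_mul_cancel₀ hM0
  have huu : hermForm σ ((StdForm.antidiagonal N).over K) u u = 0 := by rw [← hgu, hermForm_mulVec σ hgU, hxt]
  have hetet : hermForm σ ((StdForm.antidiagonal N).over K) et et = 0 := by rw [het, hermForm_smul_left_eq, hermForm_smul_right, huu, mul_zero, mul_zero]
  have hx1et : hermForm σ ((StdForm.antidiagonal N).over K) (Pi.single (Fin.rev s) 1) et = 1 := by rw [hermForm_single_left, Fin.rev_rev, het_s]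
  have hu_eq : u = lam • et := by rw [het, smul_smul, mul_inv_cancel₀ hlam0, one_smul]
  -- `ω₁ = T_{e_{rev s}}(lineProj ẽ, h(e_s, ẽ))`: `e_{rev s} ↦ e_{rev s}`, `e_s ↦ ẽ`, integral
  set ω₁ : GL (Fin N) K := lineRootGL σ ((StdForm.antidiagonal N).over K) (hermForm σ ((StdForm.antidiagonal N).over K) (Pi.single s 1) et) hx1 (hermForm_lineProj_left σ ((StdForm.antidiagonal N).over K) hσ hH hx1 hx1y1 et)
    (hermForm_left_lineProj σ ((StdForm.antidiagonal N).over K) hx1 hx1y1 et) with hω₁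
  have hω₁U : ω₁ ∈ unitaryGroupOfForm σ ((StdForm.antidiagonal N).over K) := lineRootGL_partner_mem σ ((StdForm.antidiagonal N).over K) hσ hH hx1 hy1 hx1y1 hetet hx1et
  have hω₁x : (ω₁ : Matrix (Fin N) (Fin N) K) *ᵥ Pi.single (Fin.rev s) 1 = Pi.single (Fin.rev s) 1 := by
    rw [hω₁, coe_lineRootGL]; exact lineRoot_partner_mulVec_left σ ((StdForm.antidiagonal N).over K) hσ hH hx1 hx1y1
  have hω₁y : (ω₁ : Matrix (Fin N) (Fin N) K) *ᵥ Pi.single s 1 = et := by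
    rw [hω₁, coe_lineRootGL]; exact lineRoot_partner_mulVec σ ((StdForm.antidiagonal N).over K) hσ hH hy1 hx1y1 hx1et
  have hω₁int : ∀ i j, Valued.v ((ω₁ : Matrix (Fin N) (Fin N) K) i j) ≤ 1 := fun i j => by
    rw [hω₁, coe_lineRootGL]
    refine v_lineRoot_apply_le_one σ hvσ (v_single_apply_le_one (Fin.rev s)) (fun k => v_lineProj_single_apply_le_one σ het_int _ _ k) ?_ i j
    rw [hermForm_single_left]; exact het_int _
  -- `x₂′ = (σλ)⁻¹ g⁻¹ e_{rev s}` and `ω₂ = T_{e_t}(lineProj x₂′, h(e_{rev t}, x₂′))`: `e_t ↦ e_t`, `e_{rev t} ↦ x₂′`, integral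
  set u2 : Fin N → K := fun i => (((g⁻¹ : unitaryGroupOfForm σ ((StdForm.antidiagonal N).over K)) : GL (Fin N) K) : Matrix (Fin N) (Fin N) K) i (Fin.rev s) with hu2
  have hu2val : ∀ i, u2 i = σ (A s (Fin.rev i)) := fun i => by
    show (((g⁻¹ : unitaryGroupOfForm σ ((StdForm.antidiagonal N).over K)) : GL (Fin N) K) : Matrix (Fin N) (Fin N) K) i (Fin.rev s) = _
    rw [coe_inv_apply_unitary, Fin.rev_rev]
  have hginv_u2 : (((g⁻¹ : unitaryGroupOfForm σ ((StdForm.antidiagonal N).over K)) : GL (Fin N) K) : Matrix (Fin N) (Fin N) K) *ᵥ Pi.single (Fin.rev s) 1 = u2 :=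
    mulVec_single_one_eq _ _
  set x2 : Fin N → K := (σ lam)⁻¹ • u2 with hx2
  have hx2_int : ∀ i, Valued.v (x2 i) ≤ 1 := fun i => by
    rw [hx2, Pi.smul_apply, smul_eq_mul, hu2val, map_mul, map_inv₀, hvσ, hvσ, hst]
    calc M⁻¹ * Valued.v (A s (Fin.rev i)) ≤ M⁻¹ * M := mul_le_mul' le_rfl (hle _ _)
      _ = 1 := inv_mul_cancel₀ hM0
  have hu2u2 : hermForm σ ((StdForm.antidiagonal N).over K) u2 u2 = 0 := by rw [← hginv_u2, hermForm_mulVec σ hgiU, hx1]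
  have hx2x2 : hermForm σ ((StdForm.antidiagonal N).over K) x2 x2 = 0 := by rw [hx2, hermForm_smul_left_eq, hermForm_smul_right, hu2u2, mul_zero, mul_zero]
  have htx2 : hermForm σ ((StdForm.antidiagonal N).over K) (Pi.single t 1) x2 = 1 := by
    rw [hermForm_single_left, hx2, Pi.smul_apply, smul_eq_mul, hu2val, Fin.rev_rev]; exact inv_mul_cancel₀ hσlam0
  set ω₂ : GL (Fin N) K := lineRootGL σ ((StdForm.antidiagonal N).over K) (hermForm σ ((StdForm.antidiagonal N).over K) (Pi.single (Fin.rev t) 1) x2) hxt (hermForm_lineProj_left σ ((StdForm.antidiagonal N).over K) hσ hH hxt hxtyt x2)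
    (hermForm_left_lineProj σ ((StdForm.antidiagonal N).over K) hxt hxtyt x2) with hω₂
  have hω₂U : ω₂ ∈ unitaryGroupOfForm σ ((StdForm.antidiagonal N).over K) := lineRootGL_partner_mem σ ((StdForm.antidiagonal N).over K) hσ hH hxt hyt hxtyt hx2x2 htx2
  have hω₂x : (ω₂ : Matrix (Fin N) (Fin N) K) *ᵥ Pi.single t 1 = Pi.single t 1 := by
    rw [hω₂, coe_lineRootGL]; exact lineRoot_partner_mulVec_left σ ((StdForm.antidiagonal N).over K) hσ hH hxt hxtyt
  have hω₂y : (ω₂ : Matrix (Fin N) (Fin N) K) *ᵥ Pi.single (Fin.rev t) 1 = x2 := by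
    rw [hω₂, coe_lineRootGL]; exact lineRoot_partner_mulVec σ ((StdForm.antidiagonal N).over K) hσ hH hyt hxtyt htx2
  have hω₂int : ∀ i j, Valued.v ((ω₂ : Matrix (Fin N) (Fin N) K) i j) ≤ 1 := fun i j => by
    rw [hω₂, coe_lineRootGL]
    refine v_lineRoot_apply_le_one σ hvσ (v_single_apply_le_one t) (fun k => v_lineProj_single_apply_le_one σ hx2_int _ _ k) ?_ i j
    rw [hermForm_single_left]; exact hx2_int _
  -- `ω₁⁻¹` undoes `ω₁` on `ẽ` and on `e_{rev s}`
  have hω₁inv_et : ((ω₁⁻¹ : GL (Fin N) K) : Matrix (Fin N) (Fin N) K) *ᵥ et = Pi.single s 1 := by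
    rw [← hω₁y, Matrix.mulVec_mulVec, ← Units.val_mul, inv_mul_cancel, Units.val_one, Matrix.one_mulVec]
  have hω₁inv_x : ((ω₁⁻¹ : GL (Fin N) K) : Matrix (Fin N) (Fin N) K) *ᵥ Pi.single (Fin.rev s) 1 = Pi.single (Fin.rev s) 1 := by
    conv_lhs => rw [← hω₁x]
    rw [Matrix.mulVec_mulVec, ← Units.val_mul, inv_mul_cancel, Units.val_one, Matrix.one_mulVec]
  have hAu2 : A *ᵥ u2 = Pi.single (Fin.rev s) 1 := by
    rw [← hginv_u2, Matrix.mulVec_mulVec, hA, Subgroup.coe_inv, ← Units.val_mul, mul_inv_cancel, Units.val_one, Matrix.one_mulVec]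
  refine ⟨⟨ω₁, hω₁U⟩, ⟨ω₂, hω₂U⟩, (mem_unitaryInt_iff_forall_v_le_one hvσ).2 hω₁int, (mem_unitaryInt_iff_forall_v_le_one hvσ).2 hω₂int, ?_, ?_⟩
  · rw [Subgroup.coe_mul, Subgroup.coe_mul, Subgroup.coe_inv, Units.val_mul, Units.val_mul, ← Matrix.mulVec_mulVec, ← Matrix.mulVec_mulVec]
    change ((ω₁⁻¹ : GL (Fin N) K) : Matrix (Fin N) (Fin N) K) *ᵥ (A *ᵥ ((ω₂ : Matrix (Fin N) (Fin N) K) *ᵥ Pi.single t 1)) = lam • Pi.single s 1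
    rw [hω₂x, hgu, hu_eq, Matrix.mulVec_smul, hω₁inv_et]
  · rw [Subgroup.coe_mul, Subgroup.coe_mul, Subgroup.coe_inv, Units.val_mul, Units.val_mul, ← Matrix.mulVec_mulVec, ← Matrix.mulVec_mulVec]
    change ((ω₁⁻¹ : GL (Fin N) K) : Matrix (Fin N) (Fin N) K) *ᵥ (A *ᵥ ((ω₂ : Matrix (Fin N) (Fin N) K) *ᵥ Pi.single (Fin.rev t) 1)) = (σ lam)⁻¹ • Pi.single (Fin.rev s) 1
    rw [hω₂y, hx2, Matrix.mulVec_smul, hAu2, Matrix.mulVec_smul, hω₁inv_x]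

end Step

end Summit.HodgeConjecture.HodgeConjecture.Cruxes.H413.K2E3QuasiSplitUnitaryCartanAnyInvolutionStep

end
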